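import Summits.ValiantsHypothesis.ValiantsHypothesis.Theorems.LacunarySymmetroidMatrixDescartesDoorA26WallBubblingThreePairFrame

/-!
# Wall bubbling for `DoorA26` — THREE WEYL PAIRS: the slot count of the three-pair confluent determinant IN MEMBER LANGUAGE (the `hcount` input at three pairs)

LINE / STUBS.  Crux `Theses.LacunarySymmetroid.DoorA26` (stmt-ValiantsHypothesis-19979; OPEN, typed, never asserted), line
`Cruxes/DoorA26/Lines/wall_bubbling.lean` (val-idea-15), obligation (W) `Stmt.stub_weylFaces`; statement file
`Cruxes/DoorA26/Lines/wall_bubbling_ConfluentDoor.lean` rev 5c (three-pair stratum of `Stmt.weylFaces_deepVal`).  Seat val-sym-door-p2 g13 (W1 #39); the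
three-pair analogue of W2's part B1 `…ConfluentSlots.confluentDet_zerosWithMultiplicityLE_slots` and of W1 #37 — the per-cluster `hcount` input of
`chain_ceiling` (#17) at three-pair points (ceiling there `12 + 5 = 17`, W1 #38).

* `exists_polar_ne_zero_of_threePairDet_ne_zero` — a three-pair confluent determinant that is not identically zero has an alive member;
* **`threePairDet_zerosWithMultiplicityLE_slots`** — if the three-pair determinant of the frame `W` (pairs at `0,5` / `1,4` / `2,3`) is not identically
  zero, its real zeros WITH multiplicity number at most `Σ_{w ∈ Λ}(d w + 1) − 1` (alive values, member-language degrees from the confluent degree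
  `1` at the positions `3, 4, 5`).  NO hypothesis on the three values.

Nothing in this file bears on (W)/(M)/(R) themselves, on `DoorA26`, on `MatrixDescartes` (stmt-ValiantsHypothesis-18050) or on `VP ≠ VNP`; registers
unchanged.  `--supports stmt-ValiantsHypothesis-19979 --as helper`.  [folklore: Laguerre 1898; Pólya–Szegő V] [this work] the member-language bookkeeping.
-/

-- `Summit.ValiantsHypothesis.ValiantsHypothesis.…` repeats a component by the D-0017 layout
-- (single-conjunct summit), which the `dupNamespace` linter flags; the name is mandated.
set_option linter.dupNamespace false

namespace Summit.ValiantsHypothesis.ValiantsHypothesis.Theorems.LacunarySymmetroidMatrixDescartes.WallBubbling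

open Finset Filter Topology Polynomial
open Bubbling (polar polar_comm extSum_zerosWithMultiplicity_le)
open Literature.Analysis.TotalPositivity.LaguerreRuleOfSigns (ZerosWithMultiplicityLE)
open scoped BigOperators

/-- **A three-pair confluent determinant that is not identically zero has an alive member.** [this work] -/
theorem exists_polar_ne_zero_of_threePairDet_ne_zero (δ0 : Fin 6 → ℝ) (W : Fin 6 → Matrix (Fin 2) (Fin 2) ℝ)
    (hne : ∃ t, ((Real.exp (δ0 0 * t)) • (W 0 + t • W 5) + (Real.exp (δ0 1 * t)) • (W 1 + t • W 4)
      + (Real.exp (δ0 2 * t)) • (W 2 + t • W 3)).det ≠ 0) :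
    ∃ p q, polar (W p) (W q) ≠ 0 := by
  by_contra h
  push Not at h
  obtain ⟨t, ht⟩ := hne
  apply ht
  rw [threePairDet_eq_quadForm]
  exact Finset.sum_eq_zero fun p _ => Finset.sum_eq_zero fun q _ => by rw [h p q, zero_mul]

/-- **THE SLOT COUNT OF THE THREE-PAIR CONFLUENT DETERMINANT, IN MEMBER LANGUAGE** (Laguerre–Pólya with multiplicity; the `hcount` input at three
pairs).  Confluent degree of a frame position: `1` at `3, 4, 5`, `0` elsewhere. [this work] -/
theorem threePairDet_zerosWithMultiplicityLE_slots (δ0 : Fin 6 → ℝ) (h50 : δ0 5 = δ0 0) (h41 : δ0 4 = δ0 1) (h32 : δ0 3 = δ0 2)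
    (W : Fin 6 → Matrix (Fin 2) (Fin 2) ℝ)
    (hne : ∃ t, ((Real.exp (δ0 0 * t)) • (W 0 + t • W 5) + (Real.exp (δ0 1 * t)) • (W 1 + t • W 4)
      + (Real.exp (δ0 2 * t)) • (W 2 + t • W 3)).det ≠ 0) :
    ZerosWithMultiplicityLE
      (fun t => ((Real.exp (δ0 0 * t)) • (W 0 + t • W 5) + (Real.exp (δ0 1 * t)) • (W 1 + t • W 4)
        + (Real.exp (δ0 2 * t)) • (W 2 + t • W 3)).det)
      Set.univ
      ((∑ w ∈ ((univ : Finset (Fin 6 × Fin 6)).image (fun pq => δ0 pq.1 + δ0 pq.2)).filter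
          (fun w => ∃ p q : Fin 6, δ0 p + δ0 q = w ∧ polar (W p) (W q) ≠ 0),
        ((if (∃ p q : Fin 6, δ0 p + δ0 q = w ∧ polar (W p) (W q) ≠ 0 ∧
              (if p = 5 then 1 else if p = 4 then 1 else if p = 3 then 1 else 0) + (if q = 5 then 1 else if q = 4 then 1 else if q = 3 then 1 else 0) = 2) then 2
          else if (∃ p q : Fin 6, δ0 p + δ0 q = w ∧ polar (W p) (W q) ≠ 0 ∧
              (if p = 5 then 1 else if p = 4 then 1 else if p = 3 then 1 else 0) + (if q = 5 then 1 else if q = 4 then 1 else if q = 3 then 1 else 0) = 1) then 1 else 0) + 1)) - 1) := by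
  classical
  set V : Finset ℝ := (univ : Finset (Fin 6 × Fin 6)).image (fun pq => δ0 pq.1 + δ0 pq.2) with hV
  have hmemV : ∀ p q : Fin 6, δ0 p + δ0 q ∈ V := fun p q => Finset.mem_image.mpr ⟨(p, q), Finset.mem_univ _, rfl⟩
  -- confluent degrees
  set dg : Fin 6 → ℕ := fun p => if p = 5 then 1 else if p = 4 then 1 else if p = 3 then 1 else 0 with hdg
  have hdgle : ∀ p, dg p ≤ 1 := by intro p; simp only [hdg]; split_ifs <;> omega
  have hslot : ∀ (p : Fin 6) (t : ℝ), (if p = 5 then dslope (fun y : ℝ => Real.exp (y * t)) (δ0 0) (δ0 0)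
      else if p = 4 then dslope (fun y : ℝ => Real.exp (y * t)) (δ0 1) (δ0 1)
      else if p = 3 then dslope (fun y : ℝ => Real.exp (y * t)) (δ0 2) (δ0 2) else Real.exp (δ0 p * t))
        = t ^ dg p * Real.exp (δ0 p * t) := by
    intro p t
    by_cases hp5 : p = 5
    · subst hp5; simp only [hdg, if_true]; rw [dslope_exp_same, pow_one, h50]
    · by_cases hp4 : p = 4
      · subst hp4
        have h45 : ((4 : Fin 6) = 5) = False := by decide
        simp only [hdg, h45, if_false, if_true]
        rw [dslope_exp_same, pow_one, h41]
      · by_cases hp3 : p = 3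
        · subst hp3
          have h35 : ((3 : Fin 6) = 5) = False := by decide
          have h34 : ((3 : Fin 6) = 4) = False := by decide
          simp only [hdg, h35, h34, if_false, if_true]
          rw [dslope_exp_same, pow_one, h32]
        · simp only [hdg, hp5, hp4, hp3, if_false, pow_zero, one_mul]
  -- the slot polynomials
  set P : ℝ → ℝ[X] := fun w => ∑ p : Fin 6, ∑ q : Fin 6,
    if δ0 p + δ0 q = w then C (polar (W p) (W q)) * X ^ (dg p + dg q) else 0 with hP
  -- (a) the extended sum is the doubly-confluent determinant
  have hrep : ∀ t : ℝ, ∑ w ∈ V, (P w).eval t * Real.exp (w * t)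
      = ((Real.exp (δ0 0 * t)) • (W 0 + t • W 5) + (Real.exp (δ0 1 * t)) • (W 1 + t • W 4)
        + (Real.exp (δ0 2 * t)) • (W 2 + t • W 3)).det := by
    intro t
    rw [threePairDet_eq_quadForm]
    have h1 : ∀ w ∈ V, (P w).eval t * Real.exp (w * t)
        = ∑ p : Fin 6, ∑ q : Fin 6, if δ0 p + δ0 q = w then
            polar (W p) (W q) * t ^ (dg p + dg q) * Real.exp (w * t) else 0 := by
      intro w _
      rw [hP]
      simp only [eval_finsetSum, Finset.sum_mul]
      refine Finset.sum_congr rfl fun p _ => Finset.sum_congr rfl fun q _ => ?_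
      by_cases hv : δ0 p + δ0 q = w
      · rw [if_pos hv, if_pos hv, eval_mul, eval_C, eval_pow, eval_X]
      · rw [if_neg hv, if_neg hv, eval_zero, zero_mul]
    rw [Finset.sum_congr rfl h1, Finset.sum_comm]
    refine Finset.sum_congr rfl fun p _ => ?_
    rw [Finset.sum_comm]
    refine Finset.sum_congr rfl fun q _ => ?_
    rw [Finset.sum_ite_eq V (δ0 p + δ0 q), if_pos (hmemV p q), hslot p t, hslot q t]
    rw [show (δ0 p + δ0 q) * t = δ0 p * t + δ0 q * t by ring, Real.exp_add, pow_add]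
    ring
  -- (b) a class all of whose members are dead has the zero slot polynomial
  have hdead : ∀ w, (¬ ∃ p q : Fin 6, δ0 p + δ0 q = w ∧ polar (W p) (W q) ≠ 0) → P w = 0 := by
    intro w hw
    push Not at hw
    rw [hP]
    refine Finset.sum_eq_zero fun p _ => Finset.sum_eq_zero fun q _ => ?_
    by_cases hv : δ0 p + δ0 q = w
    · rw [if_pos hv, hw p q hv, C_0, zero_mul]
    · rw [if_neg hv]
  -- (c) degree bounds in member language
  have hdeg : ∀ w, (P w).natDegree ≤
      (if (∃ p q : Fin 6, δ0 p + δ0 q = w ∧ polar (W p) (W q) ≠ 0 ∧ dg p + dg q = 2) then 2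
        else if (∃ p q : Fin 6, δ0 p + δ0 q = w ∧ polar (W p) (W q) ≠ 0 ∧ dg p + dg q = 1) then 1 else 0) := by
    intro w
    rw [hP]
    refine natDegree_sum_le_of_forall_le _ _ fun p _ => natDegree_sum_le_of_forall_le _ _ fun q _ => ?_
    by_cases hv : δ0 p + δ0 q = w
    · rw [if_pos hv]
      by_cases hz : polar (W p) (W q) = 0
      · rw [hz, C_0, zero_mul, natDegree_zero]; exact Nat.zero_le _
      refine (natDegree_C_mul_X_pow_le _ _).trans ?_
      have hp := hdgle p; have hq := hdgle q
      by_cases h2 : dg p + dg q = 2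
      · rw [if_pos ⟨p, q, hv, hz, h2⟩]; omega
      · by_cases h1 : dg p + dg q = 1
        · by_cases h2' : ∃ p q : Fin 6, δ0 p + δ0 q = w ∧ polar (W p) (W q) ≠ 0 ∧ dg p + dg q = 2
          · rw [if_pos h2']; omega
          · rw [if_neg h2', if_pos ⟨p, q, hv, hz, h1⟩]; omega
        · have h0 : dg p + dg q = 0 := by omega
          rw [h0]; exact Nat.zero_le _
    · rw [if_neg hv, natDegree_zero]; exact Nat.zero_le _
  -- (d) an active class
  have hact : ∃ w ∈ V, P w ≠ 0 := by
    by_contra h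
    push Not at h
    obtain ⟨t, ht⟩ := hne
    exact ht (by rw [← hrep t]; exact Finset.sum_eq_zero fun w hw => by rw [h w hw, eval_zero, zero_mul])
  -- (e) the slot bound
  have hslots : (∑ w ∈ V, if P w = 0 then 0 else (P w).natDegree + 1)
      ≤ ∑ w ∈ V.filter (fun w => ∃ p q : Fin 6, δ0 p + δ0 q = w ∧ polar (W p) (W q) ≠ 0),
        ((if (∃ p q : Fin 6, δ0 p + δ0 q = w ∧ polar (W p) (W q) ≠ 0 ∧ dg p + dg q = 2) then 2
          else if (∃ p q : Fin 6, δ0 p + δ0 q = w ∧ polar (W p) (W q) ≠ 0 ∧ dg p + dg q = 1) then 1 else 0) + 1) := by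
    rw [Finset.sum_filter]
    refine Finset.sum_le_sum fun w _ => ?_
    by_cases hPw : P w = 0
    · rw [if_pos hPw]; exact Nat.zero_le _
    · have halive : ∃ p q : Fin 6, δ0 p + δ0 q = w ∧ polar (W p) (W q) ≠ 0 := by
        by_contra h; exact hPw (hdead w h)
      rw [if_neg hPw, if_pos halive]
      exact Nat.add_le_add_right (hdeg w) 1
  have hone : 1 ≤ ∑ w ∈ V.filter (fun w => ∃ p q : Fin 6, δ0 p + δ0 q = w ∧ polar (W p) (W q) ≠ 0),
        ((if (∃ p q : Fin 6, δ0 p + δ0 q = w ∧ polar (W p) (W q) ≠ 0 ∧ dg p + dg q = 2) then 2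
          else if (∃ p q : Fin 6, δ0 p + δ0 q = w ∧ polar (W p) (W q) ≠ 0 ∧ dg p + dg q = 1) then 1 else 0) + 1) := by
    obtain ⟨w₀, hw₀V, hw₀⟩ := hact
    have halive : ∃ p q : Fin 6, δ0 p + δ0 q = w₀ ∧ polar (W p) (W q) ≠ 0 := by
      by_contra h; exact hw₀ (hdead w₀ h)
    have hmem : w₀ ∈ V.filter (fun w => ∃ p q : Fin 6, δ0 p + δ0 q = w ∧ polar (W p) (W q) ≠ 0) :=
      Finset.mem_filter.mpr ⟨hw₀V, halive⟩
    refine le_trans ?_ (Finset.single_le_sum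
      (f := fun w => (if (∃ p q : Fin 6, δ0 p + δ0 q = w ∧ polar (W p) (W q) ≠ 0 ∧ dg p + dg q = 2) then 2
          else if (∃ p q : Fin 6, δ0 p + δ0 q = w ∧ polar (W p) (W q) ≠ 0 ∧ dg p + dg q = 1) then 1 else 0) + 1)
      (fun w _ => Nat.zero_le _) hmem)
    exact Nat.le_add_left 1 _
  rw [show (fun t => ((Real.exp (δ0 0 * t)) • (W 0 + t • W 5) + (Real.exp (δ0 1 * t)) • (W 1 + t • W 4)
        + (Real.exp (δ0 2 * t)) • (W 2 + t • W 3)).det)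
      = (fun t => ∑ w ∈ V, (P w).eval t * Real.exp (w * t)) from funext fun t => (hrep t).symm]
  simp only [hdg] at hslots hone
  exact extSum_zerosWithMultiplicity_le _ V P hact (by omega)

end Summit.ValiantsHypothesis.ValiantsHypothesis.Theorems.LacunarySymmetroidMatrixDescartes.WallBubbling
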